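import Literature.Analysis.FluidPDE.SereginSverakPressureTypeI
import Literature.Analysis.FluidPDE.LocalTypeIMorreyProofs
import Literature.Analysis.FluidPDE.SuitableWeakRescaling
import Literature.Analysis.FluidPDE.LocalTypeIProofs
import Literature.Analysis.FluidPDE.ClassicalTopPointRegularity
import Literature.Analysis.FluidPDE.SereginSverak2002PressureLowerBoundProofs
import HarnessLib

/-!
# One-sided pressure bounds: every potential final-time singularity is locally Type I;
# Seregin–Šverák 2002 from the non-existence of local Type I singular points

Analysis/FluidPDE proofs-layer file (theorems only) on the discharge path of the named fact
`Literature.Analysis.FluidPDE.seregin_sverak_2002` (`SereginSverakPressure.lean`; G. Seregin,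
V. Šverák, Arch. Ration. Mech. Anal. 163 (2002) 65–86, main theorem), second layer above
`SereginSverakPressureTypeI.lean` (Step 1: the scale-invariant local energy bound
`ae_energy_ball_le`).

* `exists_zoom_typeIBound_lt_top` — for a classical solution on `[0, T)` (viscosity `ν > 0`),
  Leray–Hopf on `[0, T)`, under either one-sided bound of the fact, and any `x₀`: the
  viscosity-normalising parabolic zoom `v = α u ∘ Φ`, `π = α² q ∘ Φ` about `(T, x₀)`
  (`Φ(s,y) = (T + βs, x₀ + Ry)`, `α = R/ν`, `β = R²/ν`, `q` Tao's gauge of the pressure) is a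
  suitable weak solution of the unit-viscosity system in the parabolic ball `Q(0,1)` in the class
  of Albritton–Barker 2019, Def. 2.1 (`IsSuitableWeakSolutionInBall 1 0`; the rescaling block of
  `AxisymmetricTypeIOffAxis.lean` transplanted to the present hypotheses), with the classical
  gradient as weak gradient, and its Type I quantity is finite on `Q(0, 1/2)`:
  `𝐈(Q(0,1/2)) < ∞` — the scaled energies `A` on all parabolic sub-balls of `Q(0,1)` are bounded
  by Step 1 transported along `Φ` (`ae_sliced_setLIntegral_ball_stRescale`), and the tree's
  `albrittonBarker2019_lemma_2_6_holds` (Seregin 2006) bounds `C, D, E`.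
* `isBackwardBoundedAt_of_zoom` — an essential bound of the zoom on some `Q(0, r)` is a bound of
  `u` on a backward cylinder at `(T, x₀)` (continuity below `T`).
* `seregin_sverak_2002_of_not_localTypeISingularityExists` — CONSEQUENTLY the fact follows from
  the non-existence of local Type I singular points of suitable weak solutions
  (`¬ LocalTypeISingularityExists`, the registered OPEN statement of `LocalTypeI.lean`,
  Albritton–Barker 2019, Thm. 1.1; false under the Liouville conjecture (L) of KNSS 2009): a
  final-time point where `u` is not backward bounded would make the origin a backward singular
  point of the zoom, hence a local Type I singular point. The paper's own last step (its §3)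
  replaces this open input by an argument using the sign of the limiting pressure; it is not
  vendored here (primary source unavailable on this hub, acquisition acq-01580).

## References

* G. Seregin, V. Šverák, Arch. Ration. Mech. Anal. 163 (2002) 65–86, main theorem. [SereginSverak2002]
* D. Albritton, T. Barker, J. Math. Fluid Mech. 21 (2019) = arXiv:1811.00502, Thm. 1.1, Def. 2.1,
  Lemma 2.6. [AlbrittonBarker2019]
* G. Seregin, J. Math. Sci. 143 (2007) = arXiv:math/0607537, Lemma 2.1 (c). [Seregin2006]
-/

noncomputable section

open Set Filter Topology MeasureTheory
open scoped ContDiff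

namespace Literature.Analysis.FluidPDE

namespace SereginSverak2002


section LocalTypeI

open InnerProductSpace Function TopologicalSpace Metric
open scoped RealInnerProductSpace ENNReal NNReal

/-- Local notation for physical space `ℝ³ = EuclideanSpace ℝ (Fin 3)`. -/
local notation "ℝ³" => EuclideanSpace ℝ (Fin 3)

variable {ν T : ℝ} {u : ℝ → ℝ³ → ℝ³} {p : ℝ → ℝ³ → ℝ}

/-- **Finite dissipation of the classical gradient on the slab** `∫∫_{(0,T)×ℝ³} |∇u|² < ⊤`
(the classical gradient is a weak spatial gradient on the slab, hence agrees a.e. with the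
square-integrable Leray–Hopf gradient). [folklore] -/
theorem lintegral_slab_frobeniusNormSq_fderiv_lt_top' (hsol : IsClassicalNSSolutionOn (Ico 0 T) ν 0 u p)
    (hLH : IsLerayHopfOn T ν 0 (u 0) u) :
    ∫⁻ z in Ioo 0 T ×ˢ (univ : Set ℝ³), ENNReal.ofReal (frobeniusNormSq (fderiv ℝ (u z.1) z.2)) < ⊤ := by
  obtain ⟨G', hG'slab, -, hG'int, -⟩ := hLH.exists_hasWeakSpatialGradientOn
  have hGu : HasWeakSpatialGradientOn (slab ℝ³ (Ioo 0 T) isOpen_Ioo) u fun t x => fderiv ℝ (u t) x :=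
    hasWeakSpatialGradientOn_of_contDiffOn isOpen_Ioo (by rw [coe_slab])
      ((classical_Ioo hsol).smooth_velocity.of_le (by norm_cast))
  have hae := hGu.ae_eq hG'slab
  rw [coe_slab] at hae
  calc ∫⁻ z in Ioo 0 T ×ˢ (univ : Set ℝ³), ENNReal.ofReal (frobeniusNormSq (fderiv ℝ (u z.1) z.2))
      = ∫⁻ z in Ioo 0 T ×ˢ (univ : Set ℝ³), ENNReal.ofReal (frobeniusNormSq (G' z.1 z.2)) := by
        refine lintegral_congr_ae ?_
        filter_upwards [hae] with z hz
        change ENNReal.ofReal (frobeniusNormSq (uncurry (fun t x => fderiv ℝ (u t) x) z)) =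
          ENNReal.ofReal (frobeniusNormSq (uncurry G' z))
        rw [hz]
    _ < ⊤ := hG'int

/-- **The viscosity-normalising zoom about a final-time point is locally Type I.** For a
classical solution on `[0, T)` (viscosity `ν > 0`) which is Leray–Hopf on `[0, T)` and satisfies
one of the one-sided bounds of the fact, and any `x₀`, there are `R, α, β > 0` such that, with the
gauged pressure `q = p − c(t)` and `Φ(s, y) = (T + βs, x₀ + Ry)`, the pair
`v = α u ∘ Φ`, `π = α² q ∘ Φ` is a suitable weak solution of the unit-viscosity system in the
parabolic ball `Q(0, 1)` (Albritton–Barker Def. 2.1) whose Type I quantity on `Q(0, 1/2)` is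
finite: `𝐈(Q(0, 1/2)) < ⊤` (all of `A, C, D, E` bounded on all parabolic sub-balls), the scaled
energies `A` being bounded by Step 1 (`ae_energy_ball_le`) and the others by the tree's
`albrittonBarker2019_lemma_2_6_holds` (Seregin 2006). [cite: AlbrittonBarker2019, Lemma 2.6 and Def. 2.1] -/
theorem exists_zoom_typeIBound_lt_top (hν : 0 < ν) (hT : 0 < T)
    (hsol : IsClassicalNSSolutionOn (Ico 0 T) ν 0 u p) (hLH : IsLerayHopfOn T ν 0 (u 0) u)
    (hone : (∃ K : ℝ, ∀ t ∈ Ioo 0 T, ∀ x, ‖u t x‖ ^ 2 / 2 + normalisedPressure (u t) x ≤ K) ∨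
      (∃ K : ℝ, ∀ t ∈ Ioo 0 T, ∀ x, -K ≤ normalisedPressure (u t) x)) (x₀ : ℝ³) :
    ∃ R α β : ℝ, 0 < R ∧ 0 < α ∧ 0 < β ∧ β = R ^ 2 / ν ∧ α = R / ν ∧ β ≤ T ∧
      IsSuitableWeakSolutionInBall 1 0 (α • stPull β R T x₀ u)
        (α ^ 2 • stPull β R T x₀ fun t x => p t x - (p t 0 - normalisedPressure (u t) 0)) ∧
      HasWeakSpatialGradientOn (parabolicCylinderOpens 1 (0 : ℝ × ℝ³)) (α • stPull β R T x₀ u)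
        ((α * R) • stPull β R T x₀ fun t x => fderiv ℝ (u t) x) ∧
      typeIBound (parabolicCylinder (1 / 2) (0 : ℝ × ℝ³)) (α • stPull β R T x₀ u)
        (α ^ 2 • stPull β R T x₀ fun t x => p t x - (p t 0 - normalisedPressure (u t) 0))
        ((α * R) • stPull β R T x₀ fun t x => fderiv ℝ (u t) x) < ⊤ := by
  -- Step 1: the scaled energy bound for a.e. slice
  obtain ⟨M₀, hM₀⟩ := ae_energy_ball_le hν hT hsol hLH hone
  set M : ℝ := max M₀ 0 with hMdef
  have hM0 : 0 ≤ M := le_max_right _ _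
  have hM : ∀ᵐ t ∂(volume.restrict (Ioo 0 T)), ∀ (x₁ : ℝ³) (r : ℝ), 0 < r → 17 * r ≤ 1 →
      ∫ x in ball x₁ r, ‖u t x‖ ^ 2 ≤ M * r := by
    filter_upwards [hM₀] with t ht x₁ r hr hr17
    exact (ht x₁ r hr hr17).trans (mul_le_mul_of_nonneg_right (le_max_left _ _) hr.le)
  -- scales: `R ≤ 1/17`, `R² / ν ≤ T`
  set R : ℝ := min (1 / 17) (Real.sqrt (ν * T)) with hR
  have hRpos : 0 < R := lt_min (by norm_num) (Real.sqrt_pos.2 (by positivity))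
  have hR17 : R ≤ 1 / 17 := min_le_left _ _
  set α : ℝ := R / ν with hα
  set β : ℝ := R ^ 2 / ν with hβdef
  have hαpos : 0 < α := by positivity
  have hβpos : 0 < β := by positivity
  have hβeq : β = α * R := by rw [hβdef, hα]; field_simp
  have hβT : β ≤ T := by
    have h1 : R ≤ Real.sqrt (ν * T) := min_le_right _ _
    have h2 : R ^ 2 ≤ ν * T := by
      have := pow_le_pow_left₀ hRpos.le h1 2
      rwa [Real.sq_sqrt (by positivity)] at this
    rw [hβdef, div_le_iff₀ hν]; linarith
  refine ⟨R, α, β, hRpos, hαpos, hβpos, rfl, rfl, hβT, ?_⟩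
  -- the gauged pressure
  set q : ℝ → ℝ³ → ℝ := fun t x => p t x - (p t 0 - normalisedPressure (u t) 0) with hq
  -- the `ν`-cylinder `(T - β, T) × B(x₀, R)` inside the slab, and its preimage `Q(0,1)`
  set PO : Opens (ℝ × ℝ³) := ⟨Ioo (T - β) T ×ˢ ball x₀ R, isOpen_Ioo.prod isOpen_ball⟩ with hPO
  have hPOslab : (PO : Set (ℝ × ℝ³)) ⊆ Ioo 0 T ×ˢ (univ : Set ℝ³) := by
    rintro ⟨t, x⟩ ⟨ht, -⟩
    exact ⟨⟨by linarith [ht.1], ht.2⟩, mem_univ _⟩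
  have hpre1 : stPreimage β R T x₀ PO = parabolicCylinderOpens 1 (0 : ℝ × ℝ³) := by
    apply Opens.ext
    rw [coe_stPreimage]
    have h := stAffine_preimage_cylinder_eq_parabolicCylinder hν hRpos T x₀ R
    rw [div_self hRpos.ne'] at h
    exact h
  -- suitability of the zoom on `Q(0,1)` with unit viscosity
  have hsuit1 : IsSuitableWeakSolutionOn (parabolicCylinderOpens 1 (0 : ℝ × ℝ³)) 1 0
      (α • stPull β R T x₀ u) (α ^ 2 • stPull β R T x₀ q) := by
    have h0 := (isSuitableWeakSolutionOn_gauge_of_classical hν hT hsol hLH PO hPOslab).stRescale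
      hαpos hRpos hβeq T x₀
    have hvisc : α * ν / R = 1 := by rw [hα, div_mul_cancel₀ R hν.ne', div_self hRpos.ne']
    have hforce : ((α ^ 2 * R) • stPull β R T x₀ (0 : ℝ → ℝ³ → ℝ³)) = 0 := by
      funext s y; simp [stPull]
    rw [hvisc, hforce, hpre1] at h0
    exact h0
  -- the zoomed classical gradient
  have hGu : HasWeakSpatialGradientOn PO u fun t x => fderiv ℝ (u t) x :=
    hasWeakSpatialGradientOn_of_contDiffOn isOpen_Ioo hPOslab
      ((classical_Ioo hsol).smooth_velocity.of_le (by norm_cast))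
  have hGv : HasWeakSpatialGradientOn (parabolicCylinderOpens 1 (0 : ℝ × ℝ³))
      (α • stPull β R T x₀ u) ((α * R) • stPull β R T x₀ fun t x => fderiv ℝ (u t) x) := by
    rw [← hpre1]
    exact hGu.stRescale α hβpos hRpos T x₀
  -- the class `IsSuitableWeakSolutionInBall 1 0`
  have hball : IsSuitableWeakSolutionInBall 1 0 (α • stPull β R T x₀ u) (α ^ 2 • stPull β R T x₀ q) := by
    refine ⟨hsuit1, ?_, ⟨_, hGv, ?_⟩, ?_⟩
    · -- energy class
      set CE : ENNReal := ENNReal.ofReal (2 * VectorCalculus.kineticEnergy (u 0)) with hCE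
      have hphys : ∀ᵐ t ∂(volume.restrict (Ioo (T + β * (-1)) (T + β * 0))),
          ∫⁻ x in ball x₀ R, ‖u t x‖ₑ ^ 2 ≤ CE := by
        refine (ae_restrict_mem measurableSet_Ioo).mono fun t ht => ?_
        have htI : t ∈ Icc 0 T := ⟨by nlinarith [ht.1], by have := ht.2; simp at this; exact this.le⟩
        exact (setLIntegral_le_lintegral _ _).trans (eEnergy_le hν.le hLH htI)
      have h2 := ae_sliced_setLIntegral_ball_stRescale hβpos hRpos T x₀ x₀ R (-1) 0
        (fun t x => ‖u t x‖ₑ ^ 2) hphys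
      rw [finrank_euclideanSpace_fin, sub_self, smul_zero, div_self hRpos.ne'] at h2
      set C₁ : ENNReal := ‖α‖ₑ ^ 2 * (ENNReal.ofReal (R ^ 3)⁻¹ * CE) with hC₁
      have hC₁top : C₁ ≠ ⊤ :=
        ENNReal.mul_ne_top (by simp) (ENNReal.mul_ne_top ENNReal.ofReal_ne_top ENNReal.ofReal_ne_top)
      refine ⟨C₁.toNNReal, ?_⟩
      rw [ENNReal.coe_toNNReal hC₁top]
      have hset : Ioo ((0 : ℝ × ℝ³).1 - 1 ^ 2) (0 : ℝ × ℝ³).1 = Ioo (-1 : ℝ) 0 := by simp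
      rw [hset]
      filter_upwards [h2] with s hs
      have e : ∀ y : ℝ³, ‖(α • stPull β R T x₀ u) s y‖ₑ ^ 2 =
          ‖α‖ₑ ^ 2 * ‖u (T + β * s) (x₀ + R • y)‖ₑ ^ 2 := by
        intro y
        rw [smul_stPull_apply, enorm_smul, mul_pow]
      simp only [e]
      rw [lintegral_const_mul' _ _ (by simp)]
      exact mul_le_mul' le_rfl hs
    · -- `∫_{Q(0,1)} |∇v|² < ⊤`
      have hpre : parabolicCylinder 1 (0 : ℝ × ℝ³) =
          stAffine β R T x₀ ⁻¹' (Ioo (T - (R * 1) ^ 2 / ν) T ×ˢ ball x₀ (R * 1)) := by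
        rw [hβdef, stAffine_preimage_cylinder_eq_parabolicCylinder hν hRpos T x₀ (R * 1),
          mul_div_cancel_left₀ (1 : ℝ) hRpos.ne']
        rfl
      rw [hpre, setLIntegral_frobeniusNormSq_stRescale hβpos hRpos T x₀ (α * R), finrank_euclideanSpace_fin]
      refine ENNReal.mul_lt_top (ENNReal.mul_lt_top ENNReal.ofReal_lt_top ENNReal.ofReal_lt_top) ?_
      refine lt_of_le_of_lt (lintegral_mono_set ?_) (lintegral_slab_frobeniusNormSq_fderiv_lt_top' hsol hLH)
      rw [mul_one]
      rintro ⟨t, x⟩ ⟨ht, -⟩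
      refine ⟨⟨?_, ht.2⟩, mem_univ _⟩
      have : R ^ 2 / ν = β := rfl
      linarith [ht.1]
    · -- `π ∈ L^{3/2}(Q(0,1))`
      refine ⟨hsuit1.distributional.2.2.1.aestronglyMeasurable, ?_⟩
      have h32 : ((3 : ENNReal) / 2).toReal = 3 / 2 := by rw [ENNReal.toReal_div]; norm_num
      have h32top : (3 : ENNReal) / 2 ≠ ⊤ := (ENNReal.div_lt_top (by simp) (by simp)).ne
      rw [eLpNorm_eq_lintegral_rpow_enorm_toReal (by norm_num) h32top, h32]
      refine ENNReal.rpow_lt_top_of_nonneg (by positivity) (ne_of_lt ?_)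
      have hQ1 : parabolicCylinder 1 (0 : ℝ × ℝ³) = stAffine β R T x₀ ⁻¹' (PO : Set (ℝ × ℝ³)) := by
        rw [← coe_stPreimage, hpre1]; rfl
      rw [hQ1]
      show ∫⁻ z in stAffine β R T x₀ ⁻¹' (PO : Set (ℝ × ℝ³)),
          ‖(α ^ 2 • stPull β R T x₀ q) z.1 z.2‖ₑ ^ (3 / 2 : ℝ) < ⊤
      rw [setLIntegral_enorm_rpow_stRescale hβpos hRpos T x₀ (α ^ 2) q _ (by norm_num)]
      refine ENNReal.mul_lt_top (ENNReal.mul_lt_top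
        (ENNReal.rpow_lt_top_of_nonneg (by norm_num) enorm_ne_top) ENNReal.ofReal_lt_top) ?_
      exact lt_of_le_of_lt (lintegral_mono_set hPOslab)
        (lintegral_slab_gauged_pressure_lt_top hν hT hsol hLH)
  -- the scaled energies `A` on every parabolic sub-ball of `Q(0,1)`
  set Abd : ENNReal := ‖α‖ₑ ^ 2 * (ENNReal.ofReal (R ^ 3)⁻¹ * ENNReal.ofReal (M * R)) with hAbd
  have hAbdtop : Abd < ⊤ := ENNReal.mul_lt_top (by simp)
    (ENNReal.mul_lt_top ENNReal.ofReal_lt_top ENNReal.ofReal_lt_top)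
  have hA : ∀ (r : ℝ), 0 < r → ∀ (z : ℝ × ℝ³),
      parabolicCylinder r z ⊆ parabolicCylinder 1 (0 : ℝ × ℝ³) →
      cknAEss r z (α • stPull β R T x₀ u) ≤ Abd := by
    intro r hr z hz
    obtain ⟨-, -, ht1, ht2, -⟩ := parabolicCylinder_subset_data hr hz
    simp only [Prod.fst_zero, one_pow, zero_sub] at ht1 ht2
    have hr1 : r ≤ 1 := by nlinarith
    have hRr : R * r ≤ 1 / 17 := by nlinarith
    have hsubT : Ioo (T + β * (z.1 - r ^ 2)) (T + β * z.1) ⊆ Ioo 0 T := by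
      intro t ht
      constructor
      · nlinarith [ht.1]
      · nlinarith [ht.2]
    have hphys : ∀ᵐ t ∂(volume.restrict (Ioo (T + β * (z.1 - r ^ 2)) (T + β * z.1))),
        ∫⁻ x in ball (x₀ + R • z.2) (R * r), ‖u t x‖ₑ ^ 2 ≤ ENNReal.ofReal (M * (R * r)) := by
      refine ae_restrict_of_ae_restrict_of_subset hsubT ?_
      filter_upwards [hM, ae_restrict_mem measurableSet_Ioo] with t ht htI
      have hb := ht (x₀ + R • z.2) (R * r) (by positivity) (by linarith)
      have hint : IntegrableOn (fun x => ‖u t x‖ ^ 2) (ball (x₀ + R • z.2) (R * r)) :=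
        ((hLH.memLp t ⟨htI.1.le, htI.2.le⟩).integrable_norm_pow two_ne_zero).integrableOn
      have e : ∫⁻ x in ball (x₀ + R • z.2) (R * r), ‖u t x‖ₑ ^ 2 =
          ENNReal.ofReal (∫ x in ball (x₀ + R • z.2) (R * r), ‖u t x‖ ^ 2) := by
        rw [ofReal_integral_eq_lintegral_ofReal hint (Eventually.of_forall fun x => by positivity)]
        refine lintegral_congr fun x => ?_
        rw [← ofReal_norm, ENNReal.ofReal_pow (norm_nonneg _)]
      rw [e]
      exact ENNReal.ofReal_le_ofReal hb
    have h2 := ae_sliced_setLIntegral_ball_stRescale hβpos hRpos T x₀ (x₀ + R • z.2) (R * r)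
      (z.1 - r ^ 2) z.1 (fun t x => ‖u t x‖ₑ ^ 2) hphys
    rw [finrank_euclideanSpace_fin, add_sub_cancel_left, smul_smul, inv_mul_cancel₀ hRpos.ne',
      one_smul, mul_div_cancel_left₀ r hRpos.ne'] at h2
    refine essSup_le_of_ae_le _ ?_
    filter_upwards [h2] with s hs
    have e : ∀ y : ℝ³, ‖(α • stPull β R T x₀ u) s y‖ₑ ^ 2 =
        ‖α‖ₑ ^ 2 * ‖u (T + β * s) (x₀ + R • y)‖ₑ ^ 2 := by
      intro y
      rw [smul_stPull_apply, enorm_smul, mul_pow]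
    simp only [e]
    rw [lintegral_const_mul' _ _ (by simp)]
    have hr0 : ENNReal.ofReal r ≠ 0 := (ENNReal.ofReal_pos.2 hr).ne'
    calc (ENNReal.ofReal r)⁻¹ * (‖α‖ₑ ^ 2 *
          ∫⁻ y in ball z.2 r, ‖u (T + β * s) (x₀ + R • y)‖ₑ ^ 2)
        ≤ (ENNReal.ofReal r)⁻¹ * (‖α‖ₑ ^ 2 *
            (ENNReal.ofReal (R ^ 3)⁻¹ * ENNReal.ofReal (M * (R * r)))) :=
          mul_le_mul' le_rfl (mul_le_mul' le_rfl hs)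
      _ = Abd := by
          rw [hAbd, show M * (R * r) = (M * R) * r by ring,
            ENNReal.ofReal_mul (by positivity : (0:ℝ) ≤ M * R)]
          rw [show (ENNReal.ofReal r)⁻¹ * (‖α‖ₑ ^ 2 * (ENNReal.ofReal (R ^ 3)⁻¹ *
              (ENNReal.ofReal (M * R) * ENNReal.ofReal r))) =
              ‖α‖ₑ ^ 2 * (ENNReal.ofReal (R ^ 3)⁻¹ * ENNReal.ofReal (M * R)) *
                ((ENNReal.ofReal r)⁻¹ * ENNReal.ofReal r) by ring,
            ENNReal.inv_mul_cancel hr0 ENNReal.ofReal_ne_top, mul_one]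
  have hAsup : (⨆ (r : ℝ) (_ : 0 < r) (z' : ℝ × ℝ³)
      (_ : parabolicCylinder r z' ⊆ parabolicCylinder 1 (0 : ℝ × ℝ³)),
        cknAEss r z' (α • stPull β R T x₀ u)) < ⊤ := by
    refine lt_of_le_of_lt ?_ hAbdtop
    exact iSup_le fun r => iSup_le fun hr => iSup_le fun z' => iSup_le fun hz' => hA r hr z' hz'
  exact ⟨hball, hGv, albrittonBarker2019_lemma_2_6_holds 0 _ _ hball _ hGv (Or.inl hAsup) (1 / 2)
    (by norm_num) (by norm_num)⟩

/-- **Backward boundedness from an essential bound of the zoom.** If the zoom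
`v = α u ∘ Φ` is essentially bounded on some `Q(0, r)`, `0 < r ≤ 1`, then `u` is bounded on a
backward cylinder at `(T, x₀)` (`u` is continuous below `T`). [folklore] -/
theorem isBackwardBoundedAt_of_zoom (hsol : IsClassicalNSSolutionOn (Ico 0 T) ν 0 u p) (x₀ : ℝ³)
    {R α β r : ℝ} (hR : 0 < R) (hα : 0 < α) (hβ : 0 < β) (hβT : β ≤ T) (hr : 0 < r) (hr1 : r ≤ 1)
    (hfin : eLpNorm (uncurry (α • stPull β R T x₀ u)) ⊤
      (volume.restrict (parabolicCylinder r (0 : ℝ × ℝ³))) < ⊤) :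
    IsBackwardBoundedAt u T x₀ := by
  set v := α • stPull β R T x₀ u with hv
  have hcontu := continuousOn_uncurry hsol
  have hmap : ∀ w ∈ parabolicCylinder r (0 : ℝ × ℝ³),
      ((T + β * w.1, x₀ + R • w.2) : ℝ × ℝ³) ∈ Ico 0 T ×ˢ (univ : Set ℝ³) := by
    intro w hw
    rw [mem_parabolicCylinder] at hw
    simp only [Prod.fst_zero, zero_sub] at hw
    refine ⟨⟨?_, ?_⟩, mem_univ _⟩
    · have : -1 ≤ w.1 := by nlinarith [hw.1.1]
      nlinarith
    · nlinarith [hw.1.2]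
  have hcont : ContinuousOn (uncurry v) (parabolicCylinder r (0 : ℝ × ℝ³)) := by
    have hΦ : Continuous fun w : ℝ × ℝ³ => ((T + β * w.1, x₀ + R • w.2) : ℝ × ℝ³) := by fun_prop
    have h1 : ContinuousOn (fun w : ℝ × ℝ³ => uncurry u (T + β * w.1, x₀ + R • w.2))
        (parabolicCylinder r (0 : ℝ × ℝ³)) := hcontu.comp hΦ.continuousOn hmap
    refine (h1.const_smul α).congr fun w _ => ?_
    simp [hv, uncurry, stPull]
  have hbd := exists_forall_norm_le_of_eLpNorm_top_lt_top (isOpen_parabolicCylinder r 0) hcont hfin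
  set C : ℝ := (eLpNorm (uncurry v) ⊤ (volume.restrict (parabolicCylinder r (0 : ℝ × ℝ³)))).toReal
  set ρ : ℝ := min (R * r) (Real.sqrt β * r) with hρ
  have hρ0 : 0 < ρ := lt_min (by positivity) (by positivity)
  refine ⟨ρ, hρ0, C / α, fun t ht x hx => ?_⟩
  set s : ℝ := (t - T) / β with hs
  set y : ℝ³ := R⁻¹ • (x - x₀) with hy
  have hts : T + β * s = t := by rw [hs]; field_simp; ring
  have hxy : x₀ + R • y = x := by rw [hy, smul_smul, mul_inv_cancel₀ hR.ne', one_smul]; abel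
  have hρR : ρ ≤ R * r := min_le_left _ _
  have hρβ : ρ ^ 2 ≤ β * r ^ 2 := by
    have h1 : ρ ≤ Real.sqrt β * r := min_le_right _ _
    have h2 := pow_le_pow_left₀ hρ0.le h1 2
    rw [mul_pow, Real.sq_sqrt hβ.le] at h2
    exact h2
  have hw : ((s, y) : ℝ × ℝ³) ∈ parabolicCylinder r (0 : ℝ × ℝ³) := by
    rw [mem_parabolicCylinder]
    simp only [Prod.fst_zero, zero_sub, Prod.snd_zero]
    refine ⟨⟨?_, ?_⟩, ?_⟩
    · rw [hs, lt_div_iff₀ hβ]; nlinarith [ht.1]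
    · rw [hs, div_lt_iff₀ hβ]; nlinarith [ht.2]
    · simp only [dist_zero_right]
      rw [hy, norm_smul, norm_inv, Real.norm_of_nonneg hR.le]
      rw [mem_ball, dist_eq_norm] at hx
      rw [inv_mul_lt_iff₀ hR]
      exact lt_of_lt_of_le hx hρR
  have hb := hbd (s, y) hw
  have e : uncurry v (s, y) = α • u t x := by
    simp [hv, uncurry, stPull, hts, hxy]
  rw [e, norm_smul, Real.norm_of_nonneg hα.le] at hb
  rw [le_div_iff₀ hα, mul_comm]
  exact hb

/-- **Seregin–Šverák 2002 from the non-existence of local Type I singular points.** If no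
suitable weak solution of the unforced unit-viscosity system has a Type I singular point in the
sense of Albritton–Barker 2019, Thm. 1.1 (i.e. the registered open statement
`LocalTypeISingularityExists` of `LocalTypeI.lean` fails — e.g. under the Liouville conjecture
(L) of Koch–Nadirashvili–Seregin–Šverák 2009 with the A–B characterisation), then the named fact
`seregin_sverak_2002` holds: by `exists_zoom_typeIBound_lt_top`, a final-time singular point under
a one-sided pressure/head bound would be a local Type I singular point of the zoom. This records
that the one-sided bounds place every potential singularity in the Type I regime; the paper's own
final step (its §3) replaces the open Liouville input by an argument using the sign of the
limiting pressure, not vendored here.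
[cite: SereginSverak2002, main theorem; AlbrittonBarker2019, Thm. 1.1 and Lemma 2.6] -/
theorem _root_.Literature.Analysis.FluidPDE.seregin_sverak_2002_of_not_localTypeISingularityExists
    (hno : ¬ LocalTypeISingularityExists) : seregin_sverak_2002 := by
  refine seregin_sverak_2002_of_pressureOneSidedBound
    (SereginSverak2002_pressureOneSidedBound.of_final_time ?_)
  intro ν T hν hT u p hsol hLH _hd hM x₀
  have hone : (∃ K : ℝ, ∀ t ∈ Ioo 0 T, ∀ x, ‖u t x‖ ^ 2 / 2 + normalisedPressure (u t) x ≤ K) ∨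
      (∃ K : ℝ, ∀ t ∈ Ioo 0 T, ∀ x, -K ≤ normalisedPressure (u t) x) := by
    obtain ⟨M, hM | hM⟩ := hM
    · exact Or.inr ⟨M, hM⟩
    · refine Or.inl ⟨M / 2, fun t ht x => ?_⟩
      have := hM t ht x
      linarith
  obtain ⟨R, α, β, hR, hα, hβ, -, -, hβT, hball, hGv, htypeI⟩ :=
    exists_zoom_typeIBound_lt_top hν hT hsol hLH hone x₀
  by_contra hnot
  apply hno
  have hsing : IsBackwardSingularPoint (α • stPull β R T x₀ u) (0 : ℝ × ℝ³) := by
    intro r hr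
    by_contra hfin
    have hfin' : eLpNorm (uncurry (α • stPull β R T x₀ u)) ⊤
        (volume.restrict (parabolicCylinder (min r 1) (0 : ℝ × ℝ³))) < ⊤ := by
      refine lt_of_le_of_lt (eLpNorm_mono_measure _ (Measure.restrict_mono ?_ le_rfl))
        (lt_top_iff_ne_top.2 hfin)
      exact SuitableCompactness.parabolicCylinder_zero_mono (le_min hr.le zero_le_one) (min_le_left _ _)
    exact hnot (isBackwardBoundedAt_of_zoom hsol x₀ hR hα hβ hβT (lt_min hr one_pos)
      (min_le_right _ _) hfin')
  refine ⟨1 / 2, 0, α • stPull β R T x₀ u,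
    α ^ 2 • stPull β R T x₀ (fun t x => p t x - (p t 0 - normalisedPressure (u t) 0)),
    by norm_num, ?_, hsing, _, hGv.mono (SuitableCompactness.parabolicCylinderOpens_zero_mono (by norm_num) (by norm_num)),
    htypeI⟩
  exact SuitableCompactness.isSuitableWeakSolutionInBall_of_le_radius hball (by norm_num) (by norm_num)

end LocalTypeI

end SereginSverak2002

end Literature.Analysis.FluidPDE

end
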